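import Summits.CriticalPhenomena.PercolationContinuityZ3.Theorems.Transplant.FreeNilpotentCylSubcritical
import Summits.CriticalPhenomena.PercolationContinuityZ3.Theorems.Transplant.SkeletonRankBoxProd
import Summits.CriticalPhenomena.PercolationContinuityZ3.Theorems.Transplant.BoxProdHeisenbergZ
import HarnessLib

/-!
# `X □ Cay(N_{m,2})` for every quasi-transitive `X` and every `m ≥ 3`: `θ(p_c) = 0` from the rank-`m` node alone

builds on p205010 (kernel theorem, internal audit signed; external expert review pending) — nothing in this file uses p205010.
Lane `prim-bschramm`, seat `prim-bschramm-p4` (gen 4; class map, memo `P4-GENERAL.md` §12), helper file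
(`--supports stmt-CriticalPhenomena-4575`).  Product companion of `FreeNilpotentCylSubcritical.lean`; pattern of `BoxProdHeisenbergZ.lean`
(p221669).

For `X` infinite connected locally finite quasi-transitive and `m ≥ 3`: the product `X □ Cay(N_{m,2})` carries the rank-`m` skeleton
`(fnSkeleton m).boxProdLeft X` (p222762), whose cylinders `X × Cyl_ℓ` are strictly subcritical at `p_c(X □ Cay(N_{m,2}))` by the product
slab–quotient criterion (p221269) fed with the column data of `FreeNilpotentColumn*.lean` (`boxProdFN_cylSubcritical`); growth dichotomy
(Hutchcroft for exponential `X`; amenable + Burton–Keane otherwise, `N_{m,2}` having polynomial growth) then gives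
**`bsConj4_boxProdFreeNilpotent_of_dropNodeRank : SamePDropOfSkeletonRank → θ_{X □ Cay(N_{m,2})}(v, p_c) = 0` at every vertex** —
new 'node-only' class-map entries `ℤ^k × N_{m,2}`, `H₃ × N_{m,2}`, `N_{m,2} × N_{m',2}`, `G_int × N_{m,2}`, `T_k × N_{m,2}` (the last by
Hutchcroft anyway).
[cite: BenjaminiSchramm1996, Conj. 4 and §2] [cite: MartineauSevero2019, Cor. 2.2] [cite: Hutchcroft2016, Thm. 1] [cite: LyonsPeres2016, §6.1, Thm. 7.6]
[cite: KozmaNitzan2024, §1 p. 2 (approach 1)]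
-/

noncomputable section

namespace Summit.CriticalPhenomena.PercolationContinuityZ3.Theorems.Transplant

open MeasureTheory Literature.Probability.Percolation Literature.Probability.LatticeModels
open Literature.Barriers.CriticalPhenomena (IsQuasiTransitive IsGraphAmenable HasExponentialGrowth countable_of_connected_of_locallyFinite)

variable {W : Type} {m : ℕ}

/-! ## §1 The product skeleton and its cylinders -/

/-- **The rank-`m` skeleton of `X □ Cay(N_{m,2})`**: the abelianisation of the second factor. [cite: KozmaNitzan2024, §4 p. 15] -/
def boxProdFNSkeleton (X : SimpleGraph W) (hq : IsQuasiTransitive X) (m : ℕ) : Skeleton m (X □ fnGraph m) :=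
  (fnSkeleton m).boxProdLeft X hq

/-- Its base vertices are the `(v, 1)`. [folklore] -/
theorem snd_eq_zero_of_mem_boxProdFNSkeleton_types (X : SimpleGraph W) (hq : IsQuasiTransitive X) {t : W × FN m}
    (ht : t ∈ (boxProdFNSkeleton X hq m).types) : t.2 = 0 := by
  have h := ((Skeleton.mem_types_boxProdLeft X hq (fnSkeleton m) t).1 ht).2
  simpa using h

/-- **Its cylinders at `(x, 1)` are `X × Cyl_ℓ`.** [folklore] -/
theorem boxProdFNSkeleton_cyl (X : SimpleGraph W) (hq : IsQuasiTransitive X) (x : W) (ℓ : ℕ) :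
    (boxProdFNSkeleton X hq m).cyl (x, (0 : FN m)) ℓ = (Set.univ : Set W) ×ˢ (fnSkeleton m).cyl 0 ℓ := by
  rw [boxProdFNSkeleton, Skeleton.cyl_boxProdLeft]

/-! ## §2 Input Φ2 of the product skeleton at `p_c`: the slab–quotient criterion on the product -/

/-- The family of column shifts (left translations by `K = ⟨e_{i₀}⟩ · Z`). [folklore] -/
def fnColShifts (i₀ : Fin m) (L : ℕ) : Set (fnColGraph i₀ L ≃g fnColGraph i₀ L) :=
  Set.range fun tc : ℤ × (Pr m → ℤ) => colShift i₀ L tc.1 tc.2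

/-- **The cylinders `X × Cyl_ℓ` of `X □ Cay(N_{m,2})` do not percolate at `p_c(X □ Cay(N_{m,2}))`** (`X` connected, locally finite,
quasi-transitive; generators `j₁ < j₂ < i₀`): the product slab–quotient criterion with the column `{|v_i| ≤ ℓ+1, i ≠ i₀}` and
`Γ = ⟨e_{i₀}^{2ℓ+2}⟩`. [cite: MartineauSevero2019, Cor. 2.2] -/
theorem boxProdFN_cylSubcritical_of (X : SimpleGraph W) [X.LocallyFinite] (hc : X.Connected) (hq : IsQuasiTransitive X)
    {i₀ j₁ j₂ : Fin m} (hj : j₁ < j₂) (hi : j₂ < i₀) (x : W) (ℓ : ℕ) :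
    theta ((X □ fnGraph m).induce ((Set.univ : Set W) ×ˢ (fnSkeleton m).cyl 0 ℓ))
      ⟨(x, (0 : FN m)), Set.mk_mem_prod (Set.mem_univ x) ((fnSkeleton m).phi_sub_self_mem_box 0 ℓ)⟩
      (criticalProbIOf (X □ fnGraph m) (x, (0 : FN m))) = 0 := by
  classical
  have hL : 1 ≤ ℓ + 1 := Nat.le_add_left 1 ℓ
  have hN0 : 2 * ℓ + 2 ≠ 0 := Nat.succ_ne_zero _
  refine theta_boxProd_induce_cyl_criticalProb_eq_zero X (fnGraph m) (Γ := CShift i₀ (2 * ℓ + 2)) (S := fnCol i₀ (ℓ + 1))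
    hc hq (fnSkeleton_cyl_subset_fnCol i₀ (Nat.le_succ ℓ)) (cShift_isActionByAut i₀ (2 * ℓ + 2) (ℓ + 1))
    (fun g y h => cShift_free hN0 g y h) (fnColGraph_connected hL) (fnColGraph_quasiTransitive i₀ (ℓ + 1))
    ((fnColReps i₀ (ℓ + 1)).subtype (· ∈ fnCol i₀ (ℓ + 1))) (fnColShifts i₀ (ℓ + 1)) ?_ ?_ (fnColOrigin i₀ (ℓ + 1))
    (criticalProb_fnCol_lt_one hj hi hL) (fun g y hy hgy => eq_one_of_smul_mem_cyl g y hy hgy)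
    (fun g y z hy hz h => eq_one_of_adj_smul_cyl g y z hy hz h) x ((fnSkeleton m).phi_sub_self_mem_box 0 ℓ)
  · rintro τ ⟨⟨t, c₀⟩, rfl⟩ g y
    exact colShift_smul t c₀ g y
  · intro y
    refine ⟨colShift i₀ (ℓ + 1) (-(y : FN m).1 i₀) (-(y : FN m).2 - fnBeta (Pi.single i₀ (-(y : FN m).1 i₀)) (y : FN m).1),
      ⟨(_, _), rfl⟩, Finset.mem_subtype.2 ?_⟩
    rw [colShift_apply_val, colShift_to_rep]
    exact rep_mem_fnColReps i₀ (ℓ + 1) y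

/-- … packaged as input Φ2 of the product skeleton at `p_c` (at any base vertex), for `m ≥ 3`. [cite: MartineauSevero2019, Cor. 2.2] -/
theorem boxProdFNSkeleton_cylSubcritical (X : SimpleGraph W) [X.LocallyFinite] (hc : X.Connected) (hq : IsQuasiTransitive X)
    (hm : 3 ≤ m) (v : W × FN m) : (boxProdFNSkeleton X hq m).CylSubcritical (criticalProbIOf (X □ fnGraph m) v) := by
  haveI : Countable W := countable_of_connected_of_locallyFinite X hc v.1
  have hconn : (X □ fnGraph m).Connected := hc.boxProd (fnGraph_connected m)
  obtain ⟨i₀, j₁, j₂, hj, hi⟩ := exists_three_gens hm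
  intro t' ht' ℓ
  obtain ⟨x', y'⟩ := t'
  have hy' : y' = 0 := snd_eq_zero_of_mem_boxProdFNSkeleton_types X hq ht'
  subst hy'
  rw [theta_induce_congr (X □ fnGraph m) (boxProdFNSkeleton_cyl X hq x' ℓ)]
  have hpc : criticalProbIOf (X □ fnGraph m) v = criticalProbIOf (X □ fnGraph m) (x', (0 : FN m)) :=
    Subtype.ext (criticalProb_eq_of_reachable _ (hconn.preconnected _ _))
  rw [hpc]
  exact boxProdFN_cylSubcritical_of X hc hq hj hi x' ℓ

/-! ## §3 Conjecture 4 for `X □ Cay(N_{m,2})` from the rank-`m` node -/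

/-- **`θ_{X □ Cay(N_{m,2})}(v, p_c) = 0` at every vertex, `m ≥ 3`, from the rank-`m` DROP node** (`X` connected, locally finite,
quasi-transitive): growth dichotomy — Hutchcroft for exponential growth of `X`; otherwise amenable (polynomial growth of `N_{m,2}`) +
Burton–Keane + product skeleton + Φ2 by §2.  Conditional on `SamePDropOfSkeletonRank` only.
[cite: BenjaminiSchramm1996, Conj. 4] [cite: Hutchcroft2016, Thm. 1] [cite: KozmaNitzan2024, §1 p. 2 (approach 1)] -/
theorem bsConj4_boxProdFreeNilpotent_of_dropNodeRank (hD : SamePDropOfSkeletonRank) (hm : 3 ≤ m) (X : SimpleGraph W) [X.LocallyFinite]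
    (hc : X.Connected) (hq : IsQuasiTransitive X) (v : W × FN m) :
    theta (X □ fnGraph m) v (criticalProbIOf (X □ fnGraph m) v) = 0 := by
  classical
  by_cases hg : HasExponentialGrowth X
  · exact theta_boxProd_criticalProb_eq_zero_of_expGrowth X (fnGraph m) hc (fnGraph_connected m) hq fnGraph_quasiTransitive hg v
  · have hconn : (X □ fnGraph m).Connected := hc.boxProd (fnGraph_connected m)
    haveI : Countable W := countable_of_connected_of_locallyFinite X hc v.1
    haveI : Nonempty (FN m) := ⟨0⟩
    obtain ⟨t, ht, -⟩ := (boxProdFNSkeleton X hq m).frame v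
    have h0 : theta (X □ fnGraph m) t (criticalProbIOf (X □ fnGraph m) t) = 0 :=
      continuity_boxProd_of_dropNodeRank hD (by omega) X (fnGraph m) hc hq hg (fnGraph_connected m) fnGraph_quasiTransitive
        (m + 2 * Fintype.card (Pr m)) ballVolume_fnGraph_le (fnSkeleton m) t ht (boxProdFNSkeleton_cylSubcritical X hc hq hm t)
    exact theta_criticalProbIOf_eq_zero_of_reachable (X □ fnGraph m) (hconn.preconnected _ _) h0

/-- **All hypotheses of Benjamini–Schramm's Conjecture 4 hold for `X □ Cay(N_{m,2})`, `m ≥ 3`** (connected, quasi-transitive,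
`p_c < 1`). [cite: BenjaminiSchramm1996, Conj. 4 and §2] -/
theorem boxProdFreeNilpotent_conj4_hypotheses (hm : 3 ≤ m) (X : SimpleGraph W) [X.LocallyFinite] (hc : X.Connected)
    (hq : IsQuasiTransitive X) (x : W) :
    (X □ fnGraph m).Connected ∧ IsQuasiTransitive (X □ fnGraph m) ∧ criticalProb (X □ fnGraph m) (x, (0 : FN m)) < 1 := by
  haveI : Countable W := countable_of_connected_of_locallyFinite X hc x
  exact ⟨hc.boxProd (fnGraph_connected m), isQuasiTransitive_boxProd hq fnGraph_quasiTransitive,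
    (criticalProb_boxProd_le_right X (fnGraph m) x 0).trans_lt (criticalProb_fnGraph_lt_one hm)⟩

end Summit.CriticalPhenomena.PercolationContinuityZ3.Theorems.Transplant

end
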